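import Summits.Langlands.Langlands.Statement
import Summits.Langlands.Langlands.Theorems.IrreducibilityBySelfDualityIrreducibleOffSectorTransfer
import Summits.Langlands.Langlands.Theorems.IrreducibilityBySelfDualityReciprocityUpToIrreducibilityGeometricConstituents
import HarnessLib

/-!
# Change of frame in the summit's correspondence predicates
# (crux `ReciprocityUpToIrreducibility`, item stmt-Langlands-14328, line `Sketch`, continuation lead c2)

Support file (closes nothing).  The summit's predicates `SatakeFrobCompatibleAt`, `IsGeometricFramed`,
`LocalGlobalCompatibleAt` and `Corresponds` are invariant under a change of frame `ρ ↦ P ρ P⁻¹`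
(`FramedRep.conj`), and two irreducible avatars of one automorphic `π` (both Satake–Frobenius
compatible with it at almost all places) are conjugate (Chebotarev + Brauer–Nesbitt, in the tree as
`FramedGaloisRep.nonempty_equiv_of_hasFrobCharpolyAt_eventually` with `chebotarev_artinRep_holds`, and
`FramedRep.exists_eq_conj_of_equiv`).  Consequence (`corresponds_of_exists_corresponds`, the
"weak-to-strong" upgrade used by every direction-(B) engine and by the tightness certificate of line
`Sketch`): if SOME `ρ'` corresponds to `π` at every finite place, then every IRREDUCIBLE `ρ` that is
Satake–Frobenius compatible with `π` almost everywhere corresponds to `π` at every finite place, for the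
same reciprocity datum.

The only non-formal point is the place `v ∤ ℓ`: there `LocalGlobalCompatibleAt` names the Weil–Deligne
representation through the Grothendieck–Deligne recipe `IsWeilDeligneOfLadic`, a LITERAL matrix identity,
so the Weil–Deligne representation has to be conjugated along with `ρ` (`exists_glConj`,
`isWeilDeligneOfLadic_glConj`), its complex transport conjugated by `ι(P)` (`isTransportAlong_glConj`),
and the Frobenius-semisimple class shown to be an isomorphism invariant
(`hasFrobSemisimpleClass_of_isEquivalent`, transporting a Frobenius-semisimplification along a
Weil–Deligne isomorphism).  At `v ∣ ℓ` the pinned datum's structure field `PstWeilDeligneData.conj`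
keeps the same Weil–Deligne representation.  No definitions; std axioms.

## References

* J.-P. Serre, *Abelian ℓ-adic representations and elliptic curves* (1968), Ch. I §2.3.
  [SerreAbelianLadic1968]
* P. Deligne, *Les constantes des équations fonctionnelles des fonctions L*, Antwerp II (1973), §8.
  [DeligneAntwerpII1973]
* P. Deligne, J.-P. Serre, *Formes modulaires de poids 1*, ASENS 7 (1974), Lemme 3.2.
  [DeligneSerreASENS1974]
-/

noncomputable section

set_option linter.dupNamespace false -- project-wide option (lakefile weak.linter.dupNamespace); `Summit.Langlands.Langlands` is the mandated namespace

open scoped MatrixGroups Matrix NumberField Classical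
open Filter IsDedekindDomain Field
open Literature.NumberTheory.Automorphic Literature.NumberTheory.GaloisRepresentations

namespace Summit.Langlands.Langlands.Theorems.ReciprocityUpToIrreducibility

/-! ## 1. Transport of Weil–Deligne representations along a linear isomorphism -/

section WDTransport

variable {F : Type} [Field F] [ValuativeRel F] [TopologicalSpace F] [IsNonarchimedeanLocalField F]
  {C : Type*} [Field C] [CharZero C] {V W : Type*} [AddCommGroup V] [Module C V]
  [AddCommGroup W] [Module C W]

/-- **Transport of structure.**  A Weil–Deligne representation `r = (ρ, N)` on `V` and a linear
isomorphism `e : V ≃ W` give the Weil–Deligne representation `(e ρ e⁻¹, e N e⁻¹)` on `W`, isomorphic to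
`r` through `e`.  Stated as an existence (no new definition). [cite: DeligneAntwerpII1973, §8.4.1] -/
theorem exists_wdTransport (r : WeilDeligneRep F C V) (e : V ≃ₗ[C] W) :
    ∃ r' : WeilDeligneRep F C W, (∀ w, r'.ρ w = e.conjAlgEquiv C (r.ρ w)) ∧
      r'.N = e.conjAlgEquiv C r.N ∧ r.IsEquivalent r' := by
  set A : Module.End C V ≃ₐ[C] Module.End C W := e.conjAlgEquiv C with hA
  have he : ∀ f : Module.End C V, (e : V →ₗ[C] W) ∘ₗ f = A f ∘ₗ (e : V →ₗ[C] W) := fun f => by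
    refine LinearMap.ext fun v => ?_
    simp [hA, LinearEquiv.conjAlgEquiv_apply]
  let ρ' : Representation C (WeilGroup F) W :=
    { toFun := fun w => A (r.ρ w)
      map_one' := by rw [map_one, map_one]
      map_mul' := fun x y => by rw [map_mul, map_mul] }
  have hρ' : ∀ w, ρ' w = A (r.ρ w) := fun _ => rfl
  let r' : WeilDeligneRep F C W :=
    { ρ := ρ'
      isContinuous := by
        obtain ⟨U, hU, hUo, hρ⟩ := r.isContinuous
        exact ⟨U, hU, hUo, fun u hu => by rw [hρ', hρ u hu, map_one]⟩
      N := A r.N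
      isNilpotent_N := r.isNilpotent_N.map A
      conj_N := fun w => by
        rw [hρ', ← Module.End.mul_eq_comp, ← Module.End.mul_eq_comp, ← map_mul, ← map_mul,
          Module.End.mul_eq_comp, Module.End.mul_eq_comp, r.conj_N w, map_smul] }
  exact ⟨r', fun w => rfl, rfl, ⟨{ toRepEquiv := Representation.Equiv.mk e (fun g => he (r.ρ g)),
                                    comm_N := he r.N }⟩⟩

omit [CharZero C] in
/-- `e ∘ f = g ∘ e` forces `g = e f e⁻¹`. [folklore] -/
theorem eq_conjAlgEquiv_of_comp_eq (e : V ≃ₗ[C] W) {f : Module.End C V} {g : Module.End C W}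
    (h : (e : V →ₗ[C] W) ∘ₗ f = g ∘ₗ (e : V →ₗ[C] W)) : g = e.conjAlgEquiv C f := by
  rw [LinearEquiv.conjAlgEquiv_apply, ← LinearMap.comp_assoc, h, LinearMap.comp_assoc,
    LinearEquiv.comp_symm, LinearMap.comp_id]

omit [CharZero C] in
/-- `g = e f e⁻¹` gives `e ∘ f = g ∘ e`. [folklore] -/
theorem comp_eq_of_eq_conjAlgEquiv (e : V ≃ₗ[C] W) {f : Module.End C V} {g : Module.End C W}
    (h : g = e.conjAlgEquiv C f) : (e : V →ₗ[C] W) ∘ₗ f = g ∘ₗ (e : V →ₗ[C] W) := by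
  rw [h, LinearEquiv.conjAlgEquiv_apply, LinearMap.comp_assoc, LinearMap.comp_assoc,
    LinearEquiv.symm_comp, LinearMap.comp_id]

/-- **A Frobenius-semisimplification is transported along a linear isomorphism**: if `s` is a
Frobenius-semisimplification of `r` on `V` and `r', s'` are the transports of `r, s` along
`e : V ≃ W`, then `s'` is a Frobenius-semisimplification of `r'` (semisimple and nilpotent parts,
commutation and the inertia/monodromy clauses are all transported by the algebra isomorphism
`f ↦ e f e⁻¹` of endomorphism rings). [cite: DeligneAntwerpII1973, §8.5–8.6] -/
theorem isFrobSemisimplificationOf_wdTransport {r s : WeilDeligneRep F C V}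
    {r' s' : WeilDeligneRep F C W} (e : V ≃ₗ[C] W)
    (hr : ∀ w, (e : V →ₗ[C] W) ∘ₗ r.ρ w = r'.ρ w ∘ₗ (e : V →ₗ[C] W))
    (hrN : (e : V →ₗ[C] W) ∘ₗ r.N = r'.N ∘ₗ (e : V →ₗ[C] W))
    (hs : ∀ w, (e : V →ₗ[C] W) ∘ₗ s.ρ w = s'.ρ w ∘ₗ (e : V →ₗ[C] W))
    (hsN : (e : V →ₗ[C] W) ∘ₗ s.N = s'.N ∘ₗ (e : V →ₗ[C] W))
    (h : s.IsFrobSemisimplificationOf r) : s'.IsFrobSemisimplificationOf r' := by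
  obtain ⟨hN, hI, hss⟩ := h
  refine ⟨?_, fun u hu => ?_, fun w => ?_⟩
  · rw [eq_conjAlgEquiv_of_comp_eq e hsN, eq_conjAlgEquiv_of_comp_eq e hrN, hN]
  · rw [eq_conjAlgEquiv_of_comp_eq e (hs u), eq_conjAlgEquiv_of_comp_eq e (hr u), hI u hu]
  · obtain ⟨hsw, m, hm, hcomm, hsum⟩ := hss w
    refine ⟨(LinearEquiv.isSemisimple_iff (s.ρ w) _ e (hs w)).mp hsw, e.conjAlgEquiv C m,
      hm.map _, ?_, ?_⟩
    · rw [eq_conjAlgEquiv_of_comp_eq e (hs w)]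
      exact hcomm.map _
    · rw [eq_conjAlgEquiv_of_comp_eq e (hr w), eq_conjAlgEquiv_of_comp_eq e (hs w), hsum, map_add]

/-- **The Frobenius-semisimple class is an isomorphism invariant**: isomorphic complex
Weil–Deligne representations on `ℂⁿ` have Frobenius-semisimplifications in the same class
(transport a Frobenius-semisimplification of `r` along the isomorphism; it is one of `r'`, and it is
isomorphic to the original). [cite: DeligneAntwerpII1973, §8.6] -/
theorem hasFrobSemisimpleClass_of_isEquivalent {n : ℕ} {r r' : WeilDeligneRep F ℂ (Fin n → ℂ)}
    (h : r.IsEquivalent r') {c : Quotient (frobSemisimpleWDSetoid F n)}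
    (hc : r.HasFrobSemisimpleClass c) : r'.HasFrobSemisimpleClass c := by
  obtain ⟨eqv⟩ := h
  obtain ⟨s, hs, hcl⟩ := hc
  obtain ⟨s', hs'ρ, hs'N, hss'⟩ := exists_wdTransport s eqv.toRepEquiv.toLinearEquiv
  refine ⟨s', isFrobSemisimplificationOf_wdTransport eqv.toRepEquiv.toLinearEquiv
    (fun w => eqv.toRepEquiv.toIntertwiningMap.isIntertwining' w) eqv.comm_N
    (fun w => comp_eq_of_eq_conjAlgEquiv _ (hs'ρ w)) (comp_eq_of_eq_conjAlgEquiv _ hs'N) hs, ?_⟩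
  rw [← hcl]
  exact Quotient.sound hss'.symm

end WDTransport

/-! ## 2. Conjugation by `P ∈ GL_n`: the matrix form -/

section GLConj

variable {F : Type} [Field F] [ValuativeRel F] [TopologicalSpace F] [IsNonarchimedeanLocalField F]
  {C : Type*} [Field C] [CharZero C] {n : ℕ}

omit [CharZero C] in
/-- The matrix of `P f P⁻¹` (conjugation by the linear automorphism of `Cⁿ` with matrix `P`).
[folklore] -/
theorem toMatrix'_conjAlgEquiv_toLin'OfInv (P : GL (Fin n) C) (f : Module.End C (Fin n → C)) :
    LinearMap.toMatrix'
        ((Matrix.toLin'OfInv (Units.inv_mul P) (Units.mul_inv P)).conjAlgEquiv C f) =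
      (P : Matrix (Fin n) (Fin n) C) * LinearMap.toMatrix' f *
        ((P⁻¹ : GL (Fin n) C) : Matrix (Fin n) (Fin n) C) := by
  set e := Matrix.toLin'OfInv (Units.inv_mul P) (Units.mul_inv P) with he
  have h1 : (e : (Fin n → C) →ₗ[C] (Fin n → C)) = Matrix.toLin' (P : Matrix (Fin n) (Fin n) C) :=
    LinearMap.ext fun _ => rfl
  have h2 : (e.symm : (Fin n → C) →ₗ[C] (Fin n → C)) =
      Matrix.toLin' ((P⁻¹ : GL (Fin n) C) : Matrix (Fin n) (Fin n) C) :=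
    LinearMap.ext fun _ => rfl
  rw [LinearEquiv.conjAlgEquiv_apply, LinearMap.toMatrix'_comp, LinearMap.toMatrix'_comp, h1, h2,
    LinearMap.toMatrix'_toLin', LinearMap.toMatrix'_toLin', Matrix.mul_assoc]

/-- **Conjugate Weil–Deligne representation, matrix form**: for `r` on `Cⁿ` and `P ∈ GL_n(C)` there
is an isomorphic `r'` whose matrices are `P [r] P⁻¹` (representation and monodromy).
[cite: DeligneAntwerpII1973, §8.4.1] -/
theorem exists_glConj (r : WeilDeligneRep F C (Fin n → C)) (P : GL (Fin n) C) :
    ∃ r' : WeilDeligneRep F C (Fin n → C),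
      (∀ w, LinearMap.toMatrix' (r'.ρ w) =
        (P : Matrix (Fin n) (Fin n) C) * LinearMap.toMatrix' (r.ρ w) *
          ((P⁻¹ : GL (Fin n) C) : Matrix (Fin n) (Fin n) C)) ∧
      LinearMap.toMatrix' r'.N =
        (P : Matrix (Fin n) (Fin n) C) * LinearMap.toMatrix' r.N *
          ((P⁻¹ : GL (Fin n) C) : Matrix (Fin n) (Fin n) C) ∧
      r.IsEquivalent r' := by
  obtain ⟨r', hρ, hN, hiso⟩ :=
    exists_wdTransport r (Matrix.toLin'OfInv (Units.inv_mul P) (Units.mul_inv P))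
  exact ⟨r', fun w => by rw [hρ w, toMatrix'_conjAlgEquiv_toLin'OfInv],
    by rw [hN, toMatrix'_conjAlgEquiv_toLin'OfInv], hiso⟩

omit [CharZero C] in
/-- `P (A B) P⁻¹ = (P A P⁻¹) (P B P⁻¹)`. [folklore] -/
theorem units_conj_mul (P : GL (Fin n) C) (A B : Matrix (Fin n) (Fin n) C) :
    (P : Matrix (Fin n) (Fin n) C) * (A * B) * ((P⁻¹ : GL (Fin n) C) : Matrix (Fin n) (Fin n) C) =
      (P : Matrix (Fin n) (Fin n) C) * A * ((P⁻¹ : GL (Fin n) C) : Matrix (Fin n) (Fin n) C) *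
        ((P : Matrix (Fin n) (Fin n) C) * B * ((P⁻¹ : GL (Fin n) C) : Matrix (Fin n) (Fin n) C)) := by
  simp only [Matrix.mul_assoc, Units.inv_mul_cancel_left]

/-- `P exp(A) P⁻¹ = exp(P A P⁻¹)` for nilpotent `A` (Mathlib `IsNilpotent.exp_smul` for the conjugation
action of units). [folklore] -/
theorem units_conj_exp (P : GL (Fin n) C) {A : Matrix (Fin n) (Fin n) C} (hA : IsNilpotent A) :
    (P : Matrix (Fin n) (Fin n) C) * IsNilpotent.exp A * ((P⁻¹ : GL (Fin n) C) : Matrix (Fin n) (Fin n) C) =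
      IsNilpotent.exp ((P : Matrix (Fin n) (Fin n) C) * A *
        ((P⁻¹ : GL (Fin n) C) : Matrix (Fin n) (Fin n) C)) := by
  have h := IsNilpotent.exp_smul (ConjAct.toConjAct P) hA
  rw [ConjAct.units_smul_def, ConjAct.units_smul_def, ConjAct.ofConjAct_toConjAct] at h
  exact h.symm

/-- **The Grothendieck–Deligne relation is compatible with a change of frame**: if `r` is attached to
`ρW` by the recipe `IsWeilDeligneOfLadic` (same `t`, `U`, `Φ`), then the conjugate `P [r] P⁻¹` is
attached to `P ρW P⁻¹`. [cite: DeligneAntwerpII1973, §8.4.2] -/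
theorem isWeilDeligneOfLadic_glConj {ρW : WeilGroup F →* GL (Fin n) C}
    {r r' : WeilDeligneRep F C (Fin n → C)} (P : GL (Fin n) C)
    (hρ : ∀ w, LinearMap.toMatrix' (r'.ρ w) =
      (P : Matrix (Fin n) (Fin n) C) * LinearMap.toMatrix' (r.ρ w) *
        ((P⁻¹ : GL (Fin n) C) : Matrix (Fin n) (Fin n) C))
    (hN : LinearMap.toMatrix' r'.N =
      (P : Matrix (Fin n) (Fin n) C) * LinearMap.toMatrix' r.N *
        ((P⁻¹ : GL (Fin n) C) : Matrix (Fin n) (Fin n) C))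
    (h : IsWeilDeligneOfLadic ρW r) :
    IsWeilDeligneOfLadic ((MulAut.conj P).toMonoidHom.comp ρW) r' := by
  obtain ⟨t, U, Φ, hU, hUo, hΦ, ht, h1, h2⟩ := h
  have hNnil : IsNilpotent (LinearMap.toMatrix' r.N) :=
    r.isNilpotent_N.map LinearMap.toMatrixAlgEquiv'
  refine ⟨t, U, Φ, hU, hUo, hΦ, ht, fun u hu => ?_, fun m u => ?_⟩
  · have hsm : (t u).toAdd • LinearMap.toMatrix' r'.N =
        (P : Matrix (Fin n) (Fin n) C) * ((t u).toAdd • LinearMap.toMatrix' r.N) *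
          ((P⁻¹ : GL (Fin n) C) : Matrix (Fin n) (Fin n) C) := by
      rw [hN, Matrix.mul_smul, Matrix.smul_mul]
    rw [hsm, ← units_conj_exp P (hNnil.smul _), ← h1 u hu]
    simp only [MonoidHom.coe_comp, Function.comp_apply, MulEquiv.coe_toMonoidHom, MulAut.conj_apply,
      Units.val_mul]
  · have hsm : -((t u).toAdd • LinearMap.toMatrix' r'.N) =
        (P : Matrix (Fin n) (Fin n) C) * (-((t u).toAdd • LinearMap.toMatrix' r.N)) *
          ((P⁻¹ : GL (Fin n) C) : Matrix (Fin n) (Fin n) C) := by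
      rw [hN, Matrix.mul_neg, Matrix.neg_mul, Matrix.mul_smul, Matrix.smul_mul]
    rw [hsm, ← units_conj_exp P (hNnil.smul _).neg, hρ, h2 m u, units_conj_mul]
    simp only [MonoidHom.coe_comp, Function.comp_apply, MulEquiv.coe_toMonoidHom, MulAut.conj_apply,
      Units.val_mul]

/-- **Transport along `ι` is compatible with a change of frame**: if `rℂ` is `r` transported along
`ι : E →+* ℂ`, then `ι(P) [rℂ] ι(P)⁻¹` is `P [r] P⁻¹` transported along `ι`.
[cite: DeligneAntwerpII1973, §8.4.3] -/
theorem isTransportAlong_glConj {E : Type*} [Field E] [CharZero E] (ι : E →+* C)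
    {r r' : WeilDeligneRep F E (Fin n → E)} {s s' : WeilDeligneRep F C (Fin n → C)} (P : GL (Fin n) E)
    (hρ : ∀ w, LinearMap.toMatrix' (r'.ρ w) =
      (P : Matrix (Fin n) (Fin n) E) * LinearMap.toMatrix' (r.ρ w) *
        ((P⁻¹ : GL (Fin n) E) : Matrix (Fin n) (Fin n) E))
    (hN : LinearMap.toMatrix' r'.N =
      (P : Matrix (Fin n) (Fin n) E) * LinearMap.toMatrix' r.N *
        ((P⁻¹ : GL (Fin n) E) : Matrix (Fin n) (Fin n) E))
    (hρ' : ∀ w, LinearMap.toMatrix' (s'.ρ w) =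
      ((Matrix.GeneralLinearGroup.map ι P : GL (Fin n) C) : Matrix (Fin n) (Fin n) C) *
        LinearMap.toMatrix' (s.ρ w) *
        (((Matrix.GeneralLinearGroup.map ι P)⁻¹ : GL (Fin n) C) : Matrix (Fin n) (Fin n) C))
    (hN' : LinearMap.toMatrix' s'.N =
      ((Matrix.GeneralLinearGroup.map ι P : GL (Fin n) C) : Matrix (Fin n) (Fin n) C) *
        LinearMap.toMatrix' s.N *
        (((Matrix.GeneralLinearGroup.map ι P)⁻¹ : GL (Fin n) C) : Matrix (Fin n) (Fin n) C))
    (h : r.IsTransportAlong ι s) : r'.IsTransportAlong ι s' := by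
  have hP : ((Matrix.GeneralLinearGroup.map ι P : GL (Fin n) C) : Matrix (Fin n) (Fin n) C) =
      (P : Matrix (Fin n) (Fin n) E).map ι := rfl
  have hPi : (((Matrix.GeneralLinearGroup.map ι P)⁻¹ : GL (Fin n) C) : Matrix (Fin n) (Fin n) C) =
      ((P⁻¹ : GL (Fin n) E) : Matrix (Fin n) (Fin n) E).map ι := by
    rw [← map_inv]; rfl
  refine ⟨fun w => ?_, ?_⟩
  · rw [hρ' w, hρ w, h.1 w, hP, hPi, Matrix.map_mul, Matrix.map_mul]
  · rw [hN', hN, h.2, hP, hPi, Matrix.map_mul, Matrix.map_mul]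

end GLConj

/-! ## 3. The summit's predicates under a change of frame -/

section Summit

variable {K : Type} [Field K] [NumberField K] {n : ℕ} {hcpt : isCompact_glFiniteIntegralLevel n K}
  {ℓ : ℕ} [Fact ℓ.Prime]

/-- Satake–Frobenius compatibility at `v` is invariant under `ρ ↦ P ρ P⁻¹` (unramifiedness and the
characteristic polynomial of Frobenius are). [cite: SerreAbelianLadic1968, Ch. I §2.3] -/
theorem satakeFrobCompatibleAt_conj (ι : PadicAlgCl ℓ ≃+* ℂ)
    (π : AutomorphicRepData (AutomorphyDatum.gl n K hcpt)) (P : GL (Fin n) (PadicAlgCl ℓ))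
    {ρ : FramedGaloisRep K (PadicAlgCl ℓ) n} {v : HeightOneSpectrum (𝓞 K)}
    (h : SatakeFrobCompatibleAt ι π ρ v) : SatakeFrobCompatibleAt ι π (FramedRep.conj P ρ) v := by
  obtain ⟨α, hα, hur, hcp⟩ := h
  exact ⟨α, hα, (FramedGaloisRep.isUnramifiedAt_conj_iff v P ρ).mpr hur, fun 𝔓 h𝔓 σ hσ =>
    (IrreducibleOffSector.charpoly_conj P ρ σ).trans (hcp 𝔓 h𝔓 σ hσ)⟩

/-- Geometricity (pinned sense) is invariant under `ρ ↦ P ρ P⁻¹`. [cite: FontaineMazurGeometric1995, §1] -/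
theorem isGeometricFramed_conj (Rec : ReciprocityData K) (P : GL (Fin n) (PadicAlgCl ℓ))
    {ρ : FramedGaloisRep K (PadicAlgCl ℓ) n} (h : IsGeometricFramed Rec ρ) :
    IsGeometricFramed Rec (FramedRep.conj P ρ) := by
  refine ⟨h.1.mono fun v hv => (FramedGaloisRep.isUnramifiedAt_conj_iff v P ρ).mpr hv, fun v hv => ?_⟩
  rw [toLocal_conj]
  exact isDeRhamFramed_conj _ P (h.2 v hv)

/-- **Local–global compatibility at `v` is invariant under `ρ ↦ P ρ P⁻¹`.**  At `v ∣ ℓ` the pinned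
datum keeps the same Weil–Deligne representation (structure field `PstWeilDeligneData.conj`); at `v ∤ ℓ`
the Weil–Deligne representation is conjugated along with `ρ` (Grothendieck–Deligne recipe), its complex
transport by `ι(P)`, and the Frobenius-semisimple class is unchanged (isomorphism invariant).
[cite: DeligneAntwerpII1973, §8.4] -/
theorem localGlobalCompatibleAt_conj (Rec : ReciprocityData K) (ι : PadicAlgCl ℓ ≃+* ℂ)
    (π : AutomorphicRepData (AutomorphyDatum.gl n K hcpt)) (P : GL (Fin n) (PadicAlgCl ℓ))
    {ρ : FramedGaloisRep K (PadicAlgCl ℓ) n} {v : HeightOneSpectrum (𝓞 K)}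
    (h : LocalGlobalCompatibleAt Rec ι π ρ v) : LocalGlobalCompatibleAt Rec ι π (FramedRep.conj P ρ) v := by
  obtain ⟨πv, r, rℂ, hπ, hlad, hpst, htr, hcls⟩ := h
  unfold LocalGlobalCompatibleAt
  rw [toLocal_conj]
  by_cases hv : ((ℓ : ℕ) : 𝓞 K) ∈ v.asIdeal
  · exact ⟨πv, r, rℂ, hπ, fun h' => absurd hv h',
      fun hv' => (Rec.pst ℓ v hv').conj P (ρ.toLocal v) r (hpst hv'), htr, hcls⟩
  · obtain ⟨r', hr'ρ, hr'N, -⟩ := exists_glConj r P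
    obtain ⟨rℂ', hrℂ'ρ, hrℂ'N, hrr⟩ :=
      exists_glConj rℂ (Matrix.GeneralLinearGroup.map (ι : PadicAlgCl ℓ →+* ℂ) P)
    refine ⟨πv, r', rℂ', hπ, fun _ => ?_, fun hv' => absurd hv' hv,
      isTransportAlong_glConj _ P hr'ρ hr'N hrℂ'ρ hrℂ'N htr, hasFrobSemisimpleClass_of_isEquivalent hrr hcls⟩
    have hW : (FramedRep.conj P (ρ.toLocal v)).toWeilGroupHom =
        (MulAut.conj P).toMonoidHom.comp ((ρ.toLocal v).toWeilGroupHom) :=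
      MonoidHom.ext fun w => by
        simp only [FramedRep.toWeilGroupHom_apply, FramedRep.conj_apply, MonoidHom.coe_comp,
          Function.comp_apply, MulEquiv.coe_toMonoidHom, MulAut.conj_apply]
    rw [hW]
    exact isWeilDeligneOfLadic_glConj P hr'ρ hr'N (hlad hv)

/-- **`Corresponds` is invariant under `ρ ↦ P ρ P⁻¹`.** [cite: DeligneAntwerpII1973, §8.4] -/
theorem corresponds_conj (Rec : ReciprocityData K) (ι : PadicAlgCl ℓ ≃+* ℂ)
    (π : AutomorphicRepData (AutomorphyDatum.gl n K hcpt)) (P : GL (Fin n) (PadicAlgCl ℓ))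
    {ρ : FramedGaloisRep K (PadicAlgCl ℓ) n} (h : Corresponds Rec ι π ρ) :
    Corresponds Rec ι π (FramedRep.conj P ρ) :=
  ⟨h.1.mono fun _ hv => satakeFrobCompatibleAt_conj ι π P hv,
    fun _ => localGlobalCompatibleAt_conj Rec ι π P (h.2 _)⟩

/-- **`Corresponds` descends to conjugacy classes** (`IsConjugate`). [cite: DeligneAntwerpII1973, §8.4] -/
theorem corresponds_of_isConjugate {Rec : ReciprocityData K} {ι : PadicAlgCl ℓ ≃+* ℂ}
    {π : AutomorphicRepData (AutomorphyDatum.gl n K hcpt)} {ρ ρ' : FramedGaloisRep K (PadicAlgCl ℓ) n}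
    (h : Corresponds Rec ι π ρ) (hc : IsConjugate ρ ρ') : Corresponds Rec ι π ρ' := by
  obtain ⟨P, rfl⟩ := hc
  exact corresponds_conj Rec ι π P h

/-- Geometricity descends to conjugacy classes. [cite: FontaineMazurGeometric1995, §1] -/
theorem isGeometricFramed_of_isConjugate {Rec : ReciprocityData K}
    {ρ ρ' : FramedGaloisRep K (PadicAlgCl ℓ) n}
    (h : IsGeometricFramed Rec ρ) (hc : IsConjugate ρ ρ') : IsGeometricFramed Rec ρ' := by
  obtain ⟨P, rfl⟩ := hc
  exact isGeometricFramed_conj Rec P h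

/-- **Two avatars of one `π`, one of them irreducible, are conjugate** (Chebotarev + Brauer–Nesbitt:
equal Frobenius characteristic polynomials a.e. by uniqueness of Satake parameters, irreducibility
transfers, semisimple representations with the same traces are equivalent, equivalent framed
representations are conjugate). [cite: DeligneSerreASENS1974, Lemme 3.2] -/
theorem isConjugate_of_satakeFrobCompatibleAt (π : AutomorphicRepData (AutomorphyDatum.gl n K hcpt))
    (ι : PadicAlgCl ℓ ≃+* ℂ) {ρ₀ ρ : FramedGaloisRep K (PadicAlgCl ℓ) n}
    (hirr₀ : ρ₀.toGaloisRep.IsIrreducible)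
    (h₀ : ∀ᶠ v : HeightOneSpectrum (𝓞 K) in cofinite, SatakeFrobCompatibleAt ι π ρ₀ v)
    (h : ∀ᶠ v : HeightOneSpectrum (𝓞 K) in cofinite, SatakeFrobCompatibleAt ι π ρ v) :
    IsConjugate ρ₀ ρ := by
  have hirr : ρ.toGaloisRep.IsIrreducible :=
    IrreducibleOffSector.isIrreducible_of_satakeFrobCompatible π ι hirr₀ h₀ h
  obtain ⟨e⟩ := FramedGaloisRep.nonempty_equiv_of_hasFrobCharpolyAt_eventually
    chebotarev_artinRep_holds ρ₀ ρ (IrreducibleOffSector.isSemisimple_of_isIrreducible ρ₀ hirr₀)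
    (IrreducibleOffSector.isSemisimple_of_isIrreducible ρ hirr)
    (IrreducibleOffSector.eventually_hasFrobCharpolyAt_common π ι h₀ h)
  obtain ⟨P, hP⟩ := FramedRep.exists_eq_conj_of_equiv ρ₀ ρ e
  exact ⟨P, hP.symm⟩

/-- **Weak-to-strong upgrade.**  If SOME `ρ'` corresponds to `π` (via `ι`, for the reciprocity datum
`Rec`) at every finite place, then every IRREDUCIBLE `ρ` Satake–Frobenius compatible with `π` at
almost all places corresponds to `π` at every finite place: `ρ'` is irreducible by transfer, hence
conjugate to `ρ`, and `Corresponds` descends to conjugacy classes.  This is the content of the support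
item `NewtonPatching.WeakToStrong` and the engine of the tightness certificate of line `Sketch`.
[cite: DeligneSerreASENS1974, Lemme 3.2] -/
theorem corresponds_of_exists_corresponds {Rec : ReciprocityData K} {ι : PadicAlgCl ℓ ≃+* ℂ}
    {π : AutomorphicRepData (AutomorphyDatum.gl n K hcpt)} {ρ : FramedGaloisRep K (PadicAlgCl ℓ) n}
    (hirr : ρ.toGaloisRep.IsIrreducible)
    (hρ : ∀ᶠ v : HeightOneSpectrum (𝓞 K) in cofinite, SatakeFrobCompatibleAt ι π ρ v)
    (hA : ∃ ρ' : FramedGaloisRep K (PadicAlgCl ℓ) n, Corresponds Rec ι π ρ') :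
    Corresponds Rec ι π ρ := by
  obtain ⟨ρ', h'⟩ := hA
  exact corresponds_of_isConjugate h'
    (isConjugate_of_satakeFrobCompatibleAt π ι
      (IrreducibleOffSector.isIrreducible_of_satakeFrobCompatible π ι hirr hρ h'.1) h'.1 hρ)

/-- **Registered stub `stub_localGlobalCompatibleAtConj` of line `Sketch` (crux stmt-Langlands-14328),
verbatim**: local–global compatibility at a finite place is invariant under a change of frame.
[cite: DeligneAntwerpII1973, §8.4] -/
theorem stub_localGlobalCompatibleAtConj :
    ∀ (K : Type) [Field K] [NumberField K] (n : ℕ) (hcpt : isCompact_glFiniteIntegralLevel n K)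
      (Rec : ReciprocityData K) (ℓ : ℕ) [Fact ℓ.Prime] (ι : PadicAlgCl ℓ ≃+* ℂ)
      (π : CuspidalAutomorphicRepData n K hcpt) (P : GL (Fin n) (PadicAlgCl ℓ))
      (ρ : FramedGaloisRep K (PadicAlgCl ℓ) n) (v : HeightOneSpectrum (𝓞 K)),
      LocalGlobalCompatibleAt Rec ι π.1 ρ v →
        LocalGlobalCompatibleAt Rec ι π.1 (FramedRep.conj P ρ) v :=
  fun _K _ _ _n _hcpt Rec _ℓ _ ι π P _ρ _v h => localGlobalCompatibleAt_conj Rec ι π.1 P h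

end Summit

end Summit.Langlands.Langlands.Theorems.ReciprocityUpToIrreducibility

end
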